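import Summits.QuantumFields.BalabanUV.Beta.GAN24.ResolventMixedPartials
import Summits.QuantumFields.BalabanUV.Beta.GAN24.ExponentialChartMixedJets
import Summits.QuantumFields.BalabanUV.Beta.GAN24.ExponentialChartMixedBackgrounds

/-!
# `BalabanUV.Beta.GAN24.ExponentialChartMixedCovariantTaylor` — binder row G-an2-4 ∕ (CONV-C), route R7 «TWO CURRENCIES», PART 254: THE ONE-LOOP HESSIAN OF THE EXACT ABELIAN COVARIANT
# VECTOR LAPLACIAN — THE MIXED SECOND PARTIAL `∂_r|₀∂_s|₀` OF THE INVERSE EFFECTIVE COVARIANCE IN BAŁABAN's CHART `U_{s,r} = exp(iη(sA + rB))` OF TWO REAL LIPSCHITZ CONNECTIONS HAS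
# THE β-CELL's WHOLE `LimitRate` END ON `ℤ^d`, DISPLAYING ONLY `(α, β)` AND EL₁ OF `A`, `B`.  The vacuum-polarisation tensor is the symmetric BILINEAR form `(A, B) ↦ ∂_r∂_s|₀F(e^{iη(sA + rB)})`
# of the effective action in the background (PART 247 was its DIAGONAL `A = B`, i.e. `∂²_s|₀`); here the off-diagonal entry: (§1) for every volume and level, the mixed partial is the
# EXPLICIT five-diagram combination `E·X_b·E·X_a·E + E·X_a·E·X_b·E − E·X_{ba}·E − E·X_{ab}·E + E·X_c·E` (`E = c_k⁻¹`, `X_w` the words in the three coupling letters `a = P(−iA) + P(−iA)ᴴ`,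
# `b = P(−iB) + P(−iB)ᴴ`, `c = P(−(iA)(iB)∕n) + P(−(iA)(iB)∕n)ᴴ + diag(−2Σ_ν(iA_ν)(iB_ν))` — PART 251's generic mixed partial on PART 252's partial jets); (§2) the END: PART 238 on the
# alphabet `Fin 3` with PART 253's background constants `(2(1+2α)², 2(1+2α)²(6β+2))` ∕ `(3d(1+2α)², 6d(1+2α)²(2β+1))` (unit b2b-balaban-gan24-p3, gen 66; v1; generator
# `HOME/b2b-balaban-gan24-p3/gen66/records/gen/gen254.py`)

NOT IN PRINT; OUR PROOF ([folklore] bookkeeping BY NAME over PART 251 (`deriv_deriv_inv_readout_two_param`), PART 252 (`hasDerivAt_covPert_expChart₂_fst`, `mixedLetter_fst_zero`,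
`hasDerivAt_covPert_expChart₂_snd_zero`, `hasDerivAt_mixedLetter`, `covPert_expChart₂_zero_zero`), PART 253 (`lipschitzBackground_negI_mul`, `lipschitzBackground_mixedJetV`,
`boundedBackground_mixedJetZ`, `lipschitzBackground_mono`, `boundedBackground_mono`), PART 246 (`boundedBackground_zero'`), PART 238 (`conv_couplingDiagramSum_of_tendsto_background`),
PART 161 (`exists_clm_avgTow`), PART 118 (`isUnit_det_unitCovB_and_opNorm_inv_le`), `isUnit_det_calDalev`, `calDalev_inv`; Mathlib's `Fin.sum_univ_five`, `Matrix.cons_val`,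
`Pi.list_prod_apply`; [Balaban1985BackgroundPropagators] (3.3) p. 390, (3.35) p. 396 and [Balaban1987RG1] (1.20)–(1.22) p. 264 LOCATE the shapes; nothing printed is a hypothesis).
HONEST FRAMING (cell contract, verbatim): «discharging `BetaPertH` makes Bałaban's UV stability UNCONDITIONAL — a real constructive-QFT result; it is NOT the
continuum limit and NOT the Clay problem.»  HONEST DEPENDENCY (verbatim): «continuum YM on T⁴ ⇐ BetaPertH ∧ nine spine estimates (0/9 proved); BetaPertH ⇐
(D1) ∧ (D4) ∧ CAP+tail; G-an2-4 gates asym, D1 and NE2/3/4.»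

WHAT THIS FILE PROVES (0 sorry, 0 `def`; `U^{A,B}_{s,r} k ν x = exp((I·A k ν x∕n_k)·s + (I·B k ν x∕n_k)·r)`, `A, B` REAL):
* §1 **`deriv_deriv_invCov_expChart₂_eq_mixedDiagram`** (every volume `M`, every level `k`, any real `A, B`): `∂_r|₀∂_s|₀[(L^{dk}Q_k(Δ_a^{(k)} + covPert U^{A,B}_{s,r} k)⁻¹Q_kᴴ)⁻¹]` IS the
  five-diagram combination in the letters `c_k⁻¹`, `X_{[a]}`, `X_{[b]}`, `X_{[b,a]}`, `X_{[a,b]}`, `X_{[c]}` (PART 238's letter shapes).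
* §2 **`conv_deriv_deriv_invCov_expChart₂_of_tendsto`** (`d ≥ 3`, `L ≥ 2`, `a > 0`, `μ ≠ ν`, even cubic volumes `2(t+1)`): for REAL `A_t, B_t` with `LipschitzBackground (α, β)` uniformly in
  `t` and EL₁, the tower family `(t, k) ↦ ∂_r|₀∂_s|₀[(L^{dk}Q_k(Δ_a^{(k)} + covPert U^{A_t,B_t}_{s,r} k)⁻¹Q_kᴴ)⁻¹]` has `∃ κ > 0, B, B′ ≥ 0, Π` with `IsInfiniteVolumeLimit`, `UniformDecay`,
  `StepRate (√(L⁻¹))`, `KernelInputs`, `|secondMoment (Π k) − secondMoment (lim Π)| ≤ β′_d(B′∕(1−√(L⁻¹)), κ∕d)(√(L⁻¹))^k`.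
WHAT IT DOES NOT DO: the identification with half the polarisation of PART 247's `N = 2` (PART 255); Bałaban's `−∂P∂*` ∕ `aQ(U)*Q(U)` parts of `Δ_a(U)` and the non-abelian colour structure
(NE2's tier B); `d ≤ 2` ∕ odd volumes; base points other than `U = 1`.  SUPPLIER work; NEVER «G-an2-4 closed»; NOT (CONV-C), NOT D1, NOT `BetaPertH`, NOT continuum, NOT Clay.
Records: `HOME/b2b-balaban-gan24-p3/gen66/README.md`.
-/

noncomputable section

open scoped BigOperators ComplexConjugate Matrix Matrix.Norms.L2Operator
open Filter Topology

namespace Summit.QuantumFields.BalabanUV.Beta.GAN24.ExponentialChartMixedCovariantTaylor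

open Literature.MathematicalPhysics.QuantumFieldTheory.Balaban1983to89
open Literature.MathematicalPhysics.QuantumFieldTheory.Balaban1983to89.B5Prop11Plancherel (Tor fine)
open Literature.MathematicalPhysics.QuantumFieldTheory.Balaban1983to89.B5G183RateUnitTower (lev)
open Literature.MathematicalPhysics.QuantumFieldTheory.Balaban1983to89.B12Sec2to5 (betaPrime510)
open Literature.MathematicalPhysics.QuantumFieldTheory.Balaban1983to89.Beta (Site IsInfiniteVolumeLimit)
open Literature.MathematicalPhysics.QuantumFieldTheory.Balaban1983to89.Beta.FreeLegDictionary (cubic)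
open Literature.MathematicalPhysics.QuantumFieldTheory.Balaban1983to89.Beta.BlockKernelVolumeSockets (evenPeriod)
open Literature.MathematicalPhysics.QuantumFieldTheory.Balaban1983to89.Beta.VectorTails (castT)
open Literature.MathematicalPhysics.QuantumFieldTheory.Balaban1983to89.Beta.LimitRate (StepRate limKernelOf KernelInputs)
open Summit.QuantumFields.BalabanUV.T4Continuum
open Summit.QuantumFields.BalabanUV.T4Continuum.CovariantAveragingTower (avgTow)
open Summit.QuantumFields.BalabanUV.T4Continuum.BalabanAveragedTowerUnit (idx QBlev calGlev unitCovB)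
open Summit.QuantumFields.BalabanUV.T4Continuum.BalabanAveragedCoerciveTower (unitIdx)
open Summit.QuantumFields.BalabanUV.T4Continuum.KingPairingPlantedLaw (calDalev calDalev_inv isUnit_det_calDalev)
open Summit.QuantumFields.BalabanUV.T4Continuum.FirstOrderBackgroundModel (LipschitzBackground Pmodel)
open Summit.QuantumFields.BalabanUV.T4Continuum.PerturbationAlgebra (BoundedBackground)
open Summit.QuantumFields.BalabanUV.T4Continuum.AbelianCovariantLaplacian (covPert)
open Summit.QuantumFields.BalabanUV.Beta.GAN24.EffectiveFormInsertionLaw (isUnit_det_unitCovB_and_opNorm_inv_le)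
open Summit.QuantumFields.BalabanUV.Beta.GAN24.BackgroundExpansionTaylor (exists_clm_avgTow)
open Summit.QuantumFields.BalabanUV.Beta.GAN24.CouplingLetterDiagrams (conv_couplingDiagramSum_of_tendsto_background)
open Summit.QuantumFields.BalabanUV.Beta.GAN24.ExponentialChartBackgrounds (boundedBackground_zero')
open Summit.QuantumFields.BalabanUV.Beta.GAN24.ResolventMixedPartials (deriv_deriv_inv_readout_two_param)
open Summit.QuantumFields.BalabanUV.Beta.GAN24.ExponentialChartMixedJets (hasDerivAt_covPert_expChart₂_fst mixedLetter_fst_zero hasDerivAt_covPert_expChart₂_snd_zero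
  hasDerivAt_mixedLetter covPert_expChart₂_zero_zero)
open Summit.QuantumFields.BalabanUV.Beta.GAN24.ExponentialChartMixedBackgrounds (lipschitzBackground_negI_mul lipschitzBackground_mixedJetV boundedBackground_mixedJetZ
  lipschitzBackground_mono boundedBackground_mono)

variable {d : ℕ} (L : ℕ) [NeZero L]

/-! ## §1 The mixed partial is the explicit five-diagram combination (every volume, every level) -/

section Single

variable (M : Fin d → ℕ) [hM : ∀ μ, NeZero (M μ)] (a : ℝ) (ha : 0 < a)

/-- **`deriv_deriv_invCov_expChart₂_eq_mixedDiagram` — THE ONE-LOOP HESSIAN AS FIVE DIAGRAMS** [our proof]: for every volume, every level `k` and any two REAL connections `A, B`,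
      the mixed
partial `∂_r|₀∂_s|₀` of `(L^{dk}Q_k(Δ_a^{(k)} + (Δ^{U_{s,r}} − Δ^1))⁻¹Q_kᴴ)⁻¹`, `U_{s,r} = exp(iη(sA + rB))`, equals
`E·X_{[b]}·E·X_{[a]}·E + E·X_{[a]}·E·X_{[b]}·E − E·X_{[b,a]}·E − E·X_{[a,b]}·E + E·X_{[c]}·E` with `E = c_k⁻¹ = (unitCovB k)⁻¹` and the words `X_w` in the coupling letters
`a = P(−iA) + P(−iA)ᴴ + diag 0`, `b = P(−iB) + P(−iB)ᴴ + diag 0`, `c = P(−(iA)(iB)∕n) + P(−(iA)(iB)∕n)ᴴ + diag(−2Σ_ν(iA_ν)(iB_ν))` (PART 251's `deriv_deriv_inv_readout_two_param`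
      on
PART 252's `h10 ∕ ha ∕ h01 ∕ h11`; base point `U = 1`: `covPert = 0`, `(Δ_a)⁻¹ = 𝒢`, `Φ(𝒢) = unitCovB`).
[cite: Balaban1985BackgroundPropagators, (3.3) p.390, (3.35) p.396 (shapes); Balaban1987RG1, (1.20)–(1.22) p.264 (shapes)] -/
theorem deriv_deriv_invCov_expChart₂_eq_mixedDiagram (A B : (k : ℕ) → Fin d → (idx L M k → ℝ)) (k : ℕ) :
    deriv (fun r : ℝ => deriv (fun s : ℝ => (avgTow (QBlev L M) ((L : ℝ) ^ d)
        (fun k' => (calDalev L M a ha k' + covPert L M (fun k'' ν' (x' : idx L M k'') => Complex.exp ((Complex.I * (A k'' ν' x' : ℂ) / ((lev L k'' : ℕ) : ℂ)) * ((s : ℝ) : ℂ) +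
              (Complex.I * (B k'' ν' x' : ℂ) / ((lev L k'' : ℕ) : ℂ)) * ((r : ℝ) : ℂ))) k')⁻¹) k)⁻¹) 0) 0
      =
      (unitCovB L M a ha k)⁻¹ * avgTow (QBlev L M) ((L : ℝ) ^ d) (fun k' => calGlev L M a ha k' * (Pmodel L M (fun k'' ν' (x' : idx L M k'') => -(Complex.I * (B k'' ν' x' : ℂ)))
            k' + (Pmodel L M (fun k'' ν' (x' : idx L M k'') => -(Complex.I * (B k'' ν' x' : ℂ))) k')ᴴ + Matrix.diagonal ((fun (k'' : ℕ) (_ : idx L M k'') => (0 : ℂ)) k')) *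
            calGlev L M a ha k') k
          * (unitCovB L M a ha k)⁻¹ * avgTow (QBlev L M) ((L : ℝ) ^ d) (fun k' => calGlev L M a ha k' * (Pmodel L M (fun k'' ν' (x' : idx L M k'') => -(Complex.I * (A k'' ν' x' :
                ℂ))) k' + (Pmodel L M (fun k'' ν' (x' : idx L M k'') => -(Complex.I * (A k'' ν' x' : ℂ))) k')ᴴ + Matrix.diagonal ((fun (k'' : ℕ) (_ : idx L M k'') => (0 : ℂ)) k'))
                * calGlev L M a ha k') k
          * (unitCovB L M a ha k)⁻¹
        + (unitCovB L M a ha k)⁻¹ * avgTow (QBlev L M) ((L : ℝ) ^ d) (fun k' => calGlev L M a ha k' * (Pmodel L M (fun k'' ν' (x' : idx L M k'') => -(Complex.I * (A k'' ν' x' :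
              ℂ))) k' + (Pmodel L M (fun k'' ν' (x' : idx L M k'') => -(Complex.I * (A k'' ν' x' : ℂ))) k')ᴴ + Matrix.diagonal ((fun (k'' : ℕ) (_ : idx L M k'') => (0 : ℂ)) k')) *
              calGlev L M a ha k') k
          * (unitCovB L M a ha k)⁻¹ * avgTow (QBlev L M) ((L : ℝ) ^ d) (fun k' => calGlev L M a ha k' * (Pmodel L M (fun k'' ν' (x' : idx L M k'') => -(Complex.I * (B k'' ν' x' :
                ℂ))) k' + (Pmodel L M (fun k'' ν' (x' : idx L M k'') => -(Complex.I * (B k'' ν' x' : ℂ))) k')ᴴ + Matrix.diagonal ((fun (k'' : ℕ) (_ : idx L M k'') => (0 : ℂ)) k'))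
                * calGlev L M a ha k') k
          * (unitCovB L M a ha k)⁻¹
        - (unitCovB L M a ha k)⁻¹ * avgTow (QBlev L M) ((L : ℝ) ^ d) (fun k' => calGlev L M a ha k' * (Pmodel L M (fun k'' ν' (x' : idx L M k'') => -(Complex.I * (B k'' ν' x' :
              ℂ))) k' + (Pmodel L M (fun k'' ν' (x' : idx L M k'') => -(Complex.I * (B k'' ν' x' : ℂ))) k')ᴴ + Matrix.diagonal ((fun (k'' : ℕ) (_ : idx L M k'') => (0 : ℂ)) k')) *
              (calGlev L M a ha k' * (Pmodel L M (fun k'' ν' (x' : idx L M k'') => -(Complex.I * (A k'' ν' x' : ℂ))) k' + (Pmodel L M (fun k'' ν' (x' : idx L M k'') => -(Complex.I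
              * (A k'' ν' x' : ℂ))) k')ᴴ + Matrix.diagonal ((fun (k'' : ℕ) (_ : idx L M k'') => (0 : ℂ)) k')) * calGlev L M a ha k')) k
          * (unitCovB L M a ha k)⁻¹
        - (unitCovB L M a ha k)⁻¹ * avgTow (QBlev L M) ((L : ℝ) ^ d) (fun k' => calGlev L M a ha k' * (Pmodel L M (fun k'' ν' (x' : idx L M k'') => -(Complex.I * (A k'' ν' x' :
              ℂ))) k' + (Pmodel L M (fun k'' ν' (x' : idx L M k'') => -(Complex.I * (A k'' ν' x' : ℂ))) k')ᴴ + Matrix.diagonal ((fun (k'' : ℕ) (_ : idx L M k'') => (0 : ℂ)) k')) *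
              (calGlev L M a ha k' * (Pmodel L M (fun k'' ν' (x' : idx L M k'') => -(Complex.I * (B k'' ν' x' : ℂ))) k' + (Pmodel L M (fun k'' ν' (x' : idx L M k'') => -(Complex.I
              * (B k'' ν' x' : ℂ))) k')ᴴ + Matrix.diagonal ((fun (k'' : ℕ) (_ : idx L M k'') => (0 : ℂ)) k')) * calGlev L M a ha k')) k
          * (unitCovB L M a ha k)⁻¹
        + (unitCovB L M a ha k)⁻¹ * avgTow (QBlev L M) ((L : ℝ) ^ d) (fun k' => calGlev L M a ha k' * (Pmodel L M (fun k'' ν' (x' : idx L M k'') => -(Complex.I * (A k'' ν' x' :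
              ℂ)) * (Complex.I * (B k'' ν' x' : ℂ) / ((lev L k'' : ℕ) : ℂ))) k' + (Pmodel L M (fun k'' ν' (x' : idx L M k'') => -(Complex.I * (A k'' ν' x' : ℂ)) * (Complex.I * (B
              k'' ν' x' : ℂ) / ((lev L k'' : ℕ) : ℂ))) k')ᴴ + Matrix.diagonal ((fun (k'' : ℕ) (x' : idx L M k'') => -2 * ∑ ν', (Complex.I * (A k'' ν' x' : ℂ)) * (Complex.I * (B
              k'' ν' x' : ℂ))) k')) * calGlev L M a ha k') k
          * (unitCovB L M a ha k)⁻¹ := by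
  obtain ⟨Φ, hΦ⟩ := exists_clm_avgTow (QBlev L M) ((L : ℝ) ^ d) k
  have hF : ∀ s r : ℝ, (avgTow (QBlev L M) ((L : ℝ) ^ d) (fun k' => (calDalev L M a ha k' + covPert L M (fun k'' ν' (x' : idx L M k'') => Complex.exp ((Complex.I * (A k'' ν' x' :
        ℂ) / ((lev L k'' : ℕ) : ℂ)) * ((s : ℝ) : ℂ) + (Complex.I * (B k'' ν' x' : ℂ) / ((lev L k'' : ℕ) : ℂ)) * ((r : ℝ) : ℂ))) k')⁻¹) k)⁻¹
      = (Φ (calDalev L M a ha k + covPert L M (fun k'' ν' (x' : idx L M k'') => Complex.exp ((Complex.I * (A k'' ν' x' : ℂ) / ((lev L k'' : ℕ) : ℂ)) * ((s : ℝ) : ℂ) + (Complex.I *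
            (B k'' ν' x' : ℂ) / ((lev L k'' : ℕ) : ℂ)) * ((r : ℝ) : ℂ))) k)⁻¹)⁻¹ := fun s r => by
    rw [hΦ]
  simp only [hF]
  have h00 : covPert L M (fun k'' ν' (x' : idx L M k'') => Complex.exp ((Complex.I * (A k'' ν' x' : ℂ) / ((lev L k'' : ℕ) : ℂ)) * ((0 : ℝ) : ℂ) + (Complex.I * (B k'' ν' x' : ℂ) /
        ((lev L k'' : ℕ) : ℂ)) * ((0 : ℝ) : ℂ))) k = 0 :=
    covPert_expChart₂_zero_zero L M A B k
  have ec : Φ (calGlev L M a ha k) = unitCovB L M a ha k := (hΦ (calGlev L M a ha)).symm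
  have h0 : IsUnit (calDalev L M a ha k + covPert L M (fun k'' ν' (x' : idx L M k'') => Complex.exp ((Complex.I * (A k'' ν' x' : ℂ) / ((lev L k'' : ℕ) : ℂ)) * ((0 : ℝ) : ℂ) +
        (Complex.I * (B k'' ν' x' : ℂ) / ((lev L k'' : ℕ) : ℂ)) * ((0 : ℝ) : ℂ))) k).det := by
    rw [h00, add_zero]
    exact isUnit_det_calDalev L M a ha k
  have hc0 : IsUnit (Φ (calDalev L M a ha k + covPert L M (fun k'' ν' (x' : idx L M k'') => Complex.exp ((Complex.I * (A k'' ν' x' : ℂ) / ((lev L k'' : ℕ) : ℂ)) * ((0 : ℝ) : ℂ) +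
        (Complex.I * (B k'' ν' x' : ℂ) / ((lev L k'' : ℕ) : ℂ)) * ((0 : ℝ) : ℂ))) k)⁻¹).det := by
    rw [h00, add_zero, calDalev_inv, ec]
    exact (isUnit_det_unitCovB_and_opNorm_inv_le L M a ha k).1
  rw [deriv_deriv_inv_readout_two_param (calDalev L M a ha k) Φ (fun r => hasDerivAt_covPert_expChart₂_fst L M A B r k) (mixedLetter_fst_zero L M A B k)
    (hasDerivAt_covPert_expChart₂_snd_zero L M A B k) (hasDerivAt_mixedLetter L M A B k) h0 hc0]
  -- the base point: `covPert = 0`, `(Δ_a)⁻¹ = 𝒢`, `Φ(𝒢) = unitCovB`; the words through `Φ(X k) = avgTow X k`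
  have hX1 : ∀ C : (k' : ℕ) → Matrix (idx L M k') (idx L M k') ℂ,
      Φ (calGlev L M a ha k * C k * calGlev L M a ha k) = avgTow (QBlev L M) ((L : ℝ) ^ d) (fun k' => calGlev L M a ha k' * C k' * calGlev L M a ha k') k :=
    fun C => (hΦ (fun k' => calGlev L M a ha k' * C k' * calGlev L M a ha k')).symm
  have hX2 : ∀ C C' : (k' : ℕ) → Matrix (idx L M k') (idx L M k') ℂ,
      Φ (calGlev L M a ha k * C k * calGlev L M a ha k * C' k * calGlev L M a ha k)
        = avgTow (QBlev L M) ((L : ℝ) ^ d) (fun k' => calGlev L M a ha k' * C k' * (calGlev L M a ha k' * C' k' * calGlev L M a ha k')) k := by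
    intro C C'
    rw [show calGlev L M a ha k * C k * calGlev L M a ha k * C' k * calGlev L M a ha k = calGlev L M a ha k * C k * (calGlev L M a ha k * C' k * calGlev L M a ha k) by
      simp only [Matrix.mul_assoc]]
    exact (hΦ (fun k' => calGlev L M a ha k' * C k' * (calGlev L M a ha k' * C' k' * calGlev L M a ha k'))).symm
  simp only [h00, add_zero, calDalev_inv, ec]
  rw [hX2 (fun k' => (Pmodel L M (fun k'' ν' (x' : idx L M k'') => -(Complex.I * (B k'' ν' x' : ℂ))) k' + (Pmodel L M (fun k'' ν' (x' : idx L M k'') => -(Complex.I * (B k'' ν' x'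
        : ℂ))) k')ᴴ + Matrix.diagonal ((fun (k'' : ℕ) (_ : idx L M k'') => (0 : ℂ)) k')))
      (fun k' => (Pmodel L M (fun k'' ν' (x' : idx L M k'') => -(Complex.I * (A k'' ν' x' : ℂ))) k' + (Pmodel L M (fun k'' ν' (x' : idx L M k'') => -(Complex.I * (A k'' ν' x' :
            ℂ))) k')ᴴ + Matrix.diagonal ((fun (k'' : ℕ) (_ : idx L M k'') => (0 : ℂ)) k'))),
    hX2 (fun k' => (Pmodel L M (fun k'' ν' (x' : idx L M k'') => -(Complex.I * (A k'' ν' x' : ℂ))) k' + (Pmodel L M (fun k'' ν' (x' : idx L M k'') => -(Complex.I * (A k'' ν' x' :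
          ℂ))) k')ᴴ + Matrix.diagonal ((fun (k'' : ℕ) (_ : idx L M k'') => (0 : ℂ)) k')))
      (fun k' => (Pmodel L M (fun k'' ν' (x' : idx L M k'') => -(Complex.I * (B k'' ν' x' : ℂ))) k' + (Pmodel L M (fun k'' ν' (x' : idx L M k'') => -(Complex.I * (B k'' ν' x' :
            ℂ))) k')ᴴ + Matrix.diagonal ((fun (k'' : ℕ) (_ : idx L M k'') => (0 : ℂ)) k'))),
    hX1 (fun k' => (Pmodel L M (fun k'' ν' (x' : idx L M k'') => -(Complex.I * (A k'' ν' x' : ℂ))) k' + (Pmodel L M (fun k'' ν' (x' : idx L M k'') => -(Complex.I * (A k'' ν' x' :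
          ℂ))) k')ᴴ + Matrix.diagonal ((fun (k'' : ℕ) (_ : idx L M k'') => (0 : ℂ)) k'))),
    hX1 (fun k' => (Pmodel L M (fun k'' ν' (x' : idx L M k'') => -(Complex.I * (B k'' ν' x' : ℂ))) k' + (Pmodel L M (fun k'' ν' (x' : idx L M k'') => -(Complex.I * (B k'' ν' x' :
          ℂ))) k')ᴴ + Matrix.diagonal ((fun (k'' : ℕ) (_ : idx L M k'') => (0 : ℂ)) k'))),
    hX1 (fun k' => (Pmodel L M (fun k'' ν' (x' : idx L M k'') => -(Complex.I * (A k'' ν' x' : ℂ)) * (Complex.I * (B k'' ν' x' : ℂ) / ((lev L k'' : ℕ) : ℂ))) k' + (Pmodel L M (fun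
          k'' ν' (x' : idx L M k'') => -(Complex.I * (A k'' ν' x' : ℂ)) * (Complex.I * (B k'' ν' x' : ℂ) / ((lev L k'' : ℕ) : ℂ))) k')ᴴ + Matrix.diagonal ((fun (k'' : ℕ) (x' : idx
          L M k'') => -2 * ∑ ν', (Complex.I * (A k'' ν' x' : ℂ)) * (Complex.I * (B k'' ν' x' : ℂ))) k')))]

end Single

/-! ## §2 THE END of the mixed partial on `ℤ^d`, displaying only `(α, β)` and EL₁ of the two real connections -/

section End

variable (a : ℝ) (ha : 0 < a)

/-- **`conv_deriv_deriv_invCov_expChart₂_of_tendsto` — THE ONE-LOOP HESSIAN OF THE EXACT ABELIAN COVARIANT VECTOR LAPLACIAN IN BAŁABAN's CHART HAS THE β-CELL's WHOLE `LimitRate`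
      END ON
`ℤ^d`, DISPLAYING ONLY `(α, β)` AND EL₁ OF THE TWO REAL CONNECTIONS** [our proof] (`d ≥ 3`, `L ≥ 2`, `a > 0`, `μ ≠ ν`, even cubic volumes `2(t+1)`): for volume-indexed REAL
      backgrounds
`A_t, B_t`, both `LipschitzBackground (α, β)` uniformly in `t`, with pointwise limits at the fine integer readings, the tower family
`(t, k) ↦ ∂_r|₀∂_s|₀[(L^{dk}Q_k(Δ_a^{(k)} + covPert U^{A_t,B_t}_{s,r} k)⁻¹Q_kᴴ)⁻¹]`, `U^{A,B}_{s,r} = exp(iη(sA + rB))`, has `∃ κ > 0, B, B′ ≥ 0, Π` with `IsInfiniteVolumeLimit`,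
`UniformDecay`, `StepRate (√(L⁻¹))`, `KernelInputs`, `|secondMoment (Π k) − secondMoment (lim Π)| ≤ β′_d(B′∕(1−√(L⁻¹)), κ∕d)(√(L⁻¹))^k` — §1 volume by volume, then PART 238 on the
alphabet `Fin 3` (letters `−iA_t`, `−iB_t`, the mixed jets; PART 253's constants, PART 246's zero background).
[cite: Balaban1985BackgroundPropagators, (3.3) p.390, (3.35) p.396 (shapes); Balaban1987RG1, (1.20)–(1.22) p.264 (shapes)] -/
theorem conv_deriv_deriv_invCov_expChart₂_of_tendsto (hL : 2 ≤ L) (hd : 3 ≤ d) {μ ν : Fin d} (hne : μ ≠ ν) {α β : ℝ}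
    {A B : (t : ℕ) → (k : ℕ) → Fin d → (idx L (cubic d (evenPeriod t)) k → ℝ)}
    (hA : ∀ t, LipschitzBackground L (cubic d (evenPeriod t)) (fun k ν' x => (A t k ν' x : ℂ)) α β)
    (hB : ∀ t, LipschitzBackground L (cubic d (evenPeriod t)) (fun k ν' x => (B t k ν' x : ℂ)) α β)
    (hA1 : ∀ k (ν' f : Fin d) (z : Fin d → ℤ), ∃ s' : ℂ, Tendsto (fun t => ((A t k ν' (castT (cubic d (lev L k * evenPeriod t)) z, f) : ℝ) : ℂ)) atTop (𝓝 s'))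
    (hB1 : ∀ k (ν' f : Fin d) (z : Fin d → ℤ), ∃ s' : ℂ, Tendsto (fun t => ((B t k ν' (castT (cubic d (lev L k * evenPeriod t)) z, f) : ℝ) : ℂ)) atTop (𝓝 s')) :
    ∃ κ B₀ B' : ℝ, 0 < κ ∧ 0 ≤ B₀ ∧ 0 ≤ B' ∧ ∃ Pinf : ℕ → B12Beta.Kernel d,
      (∀ k, IsInfiniteVolumeLimit evenPeriod
        (fun t μ' ν' (z : Site d (evenPeriod t)) =>
          ((deriv (fun r : ℝ => deriv (fun s : ℝ => (avgTow (QBlev L (cubic d (evenPeriod t))) ((L : ℝ) ^ d)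
        (fun k' => (calDalev L (cubic d (evenPeriod t)) a ha k' + covPert L (cubic d (evenPeriod t)) (fun k'' ν' (x' : idx L (cubic d (evenPeriod t)) k'') => Complex.exp
              ((Complex.I * ((A t) k'' ν' x' : ℂ) / ((lev L k'' : ℕ) : ℂ)) * ((s : ℝ) : ℂ) + (Complex.I * ((B t) k'' ν' x' : ℂ) / ((lev L k'' : ℕ) : ℂ)) * ((r : ℝ) : ℂ))) k')⁻¹)
              k)⁻¹) 0) 0)
            ((unitIdx L (cubic d (evenPeriod t))).symm (z, μ')) ((unitIdx L (cubic d (evenPeriod t))).symm (0, ν'))).re) (Pinf k)) ∧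
      Beta.LimitRate.UniformDecay Pinf μ ν B₀ (κ / d) ∧ StepRate Pinf μ ν B' (κ / d) (Real.sqrt ((L : ℝ)⁻¹)) ∧
      (∃ K : KernelInputs d Pinf, K.θ = Real.sqrt ((L : ℝ)⁻¹) ∧ K.c₀ = betaPrime510 d (B' / (1 - Real.sqrt ((L : ℝ)⁻¹))) (κ / d) ∧ K.Pinf = limKernelOf Pinf ∧ K.μ = μ ∧ K.ν = ν) ∧
      (∀ k, |B12Beta.secondMoment (Pinf k) μ ν - B12Beta.secondMoment (limKernelOf Pinf) μ ν|
          ≤ betaPrime510 d (B' / (1 - Real.sqrt ((L : ℝ)⁻¹))) (κ / d) * Real.sqrt ((L : ℝ)⁻¹) ^ k) := by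
  have hα : 0 ≤ α := (hA 0).nonneg.1
  have hβ : 0 ≤ β := (hA 0).nonneg.2
  -- common constants for the three letters
  have hαV : α ≤ 2 * (1 + 2 * α) ^ 2 := by nlinarith [sq_nonneg α]
  have hβV : β ≤ 2 * ((1 + 2 * α) ^ 2 * (6 * β + 2)) := by nlinarith [sq_nonneg α, mul_nonneg hα hβ, mul_nonneg (mul_nonneg hα hα) hβ]
  have hW1 : (0 : ℝ) ≤ 3 * (d * (1 + 2 * α) ^ 2) := by positivity
  have hW2 : (0 : ℝ) ≤ 6 * (d * ((1 + 2 * α) ^ 2 * (2 * β + 1))) := by positivity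
  have hV : ∀ (i : Fin 3) (t : ℕ), LipschitzBackground L (cubic d (evenPeriod t)) ((fun (i : Fin 3) (t : ℕ) => (![(fun k'' ν' (x' : idx L (cubic d (evenPeriod t)) k'') =>
        -(Complex.I * ((A t) k'' ν' x' : ℂ))), (fun k'' ν' (x' : idx L (cubic d (evenPeriod t)) k'') => -(Complex.I * ((B t) k'' ν' x' : ℂ))), (fun k'' ν' (x' : idx L (cubic d
        (evenPeriod t)) k'') => -(Complex.I * ((A t) k'' ν' x' : ℂ)) * (Complex.I * ((B t) k'' ν' x' : ℂ) / ((lev L k'' : ℕ) : ℂ)))] : Fin 3 → ((k : ℕ) → Fin d → (idx L (cubic d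
        (evenPeriod t)) k → ℂ))) i) i t) (2 * (1 + 2 * α) ^ 2) (2 * ((1 + 2 * α) ^ 2 * (6 * β + 2))) := by
    intro i t
    fin_cases i
    · exact lipschitzBackground_mono L _ (lipschitzBackground_negI_mul L _ (hA t)) hαV hβV
    · exact lipschitzBackground_mono L _ (lipschitzBackground_negI_mul L _ (hB t)) hαV hβV
    · exact lipschitzBackground_mixedJetV L _ (hA t) (hB t)
  have hW : ∀ (i : Fin 3) (t : ℕ), BoundedBackground L (cubic d (evenPeriod t)) ((fun (i : Fin 3) (t : ℕ) => (![(fun (k'' : ℕ) (_ : idx L (cubic d (evenPeriod t)) k'') => (0 :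
        ℂ)), (fun (k'' : ℕ) (_ : idx L (cubic d (evenPeriod t)) k'') => (0 : ℂ)), (fun (k'' : ℕ) (x' : idx L (cubic d (evenPeriod t)) k'') => -2 * ∑ ν', (Complex.I * ((A t) k'' ν'
        x' : ℂ)) * (Complex.I * ((B t) k'' ν' x' : ℂ)))] : Fin 3 → ((k : ℕ) → (idx L (cubic d (evenPeriod t)) k → ℂ))) i) i t) (3 * (d * (1 + 2 * α) ^ 2)) (6 * (d * ((1 + 2 * α) ^
        2 * (2 * β + 1)))) := by
    intro i t
    fin_cases i
    · exact boundedBackground_zero' L _ hW1 hW2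
    · exact boundedBackground_zero' L _ hW1 hW2
    · exact boundedBackground_mixedJetZ L _ (hA t) (hB t)
  have hV1 : ∀ (i : Fin 3) k (μ' f : Fin d) (z : Fin d → ℤ), ∃ s' : ℂ,
      Tendsto (fun t => (fun (i : Fin 3) (t : ℕ) => (![(fun k'' ν' (x' : idx L (cubic d (evenPeriod t)) k'') => -(Complex.I * ((A t) k'' ν' x' : ℂ))), (fun k'' ν' (x' : idx L
            (cubic d (evenPeriod t)) k'') => -(Complex.I * ((B t) k'' ν' x' : ℂ))), (fun k'' ν' (x' : idx L (cubic d (evenPeriod t)) k'') => -(Complex.I * ((A t) k'' ν' x' : ℂ)) *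
            (Complex.I * ((B t) k'' ν' x' : ℂ) / ((lev L k'' : ℕ) : ℂ)))] : Fin 3 → ((k : ℕ) → Fin d → (idx L (cubic d (evenPeriod t)) k → ℂ))) i) i t k μ' (castT (cubic d (lev L
            k * evenPeriod t)) z, f)) atTop (𝓝 s') := by
    intro i k μ' f z
    obtain ⟨sA, hsA⟩ := hA1 k μ' f z
    obtain ⟨sB, hsB⟩ := hB1 k μ' f z
    fin_cases i
    · exact ⟨-(Complex.I * sA), (hsA.const_mul Complex.I).neg⟩
    · exact ⟨-(Complex.I * sB), (hsB.const_mul Complex.I).neg⟩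
    · exact ⟨-(Complex.I * sA) * (Complex.I * sB / ((lev L k : ℕ) : ℂ)), (hsA.const_mul Complex.I).neg.mul ((hsB.const_mul Complex.I).div_const _)⟩
  have hW1' : ∀ (i : Fin 3) k (f : Fin d) (z : Fin d → ℤ), ∃ s' : ℂ,
      Tendsto (fun t => (fun (i : Fin 3) (t : ℕ) => (![(fun (k'' : ℕ) (_ : idx L (cubic d (evenPeriod t)) k'') => (0 : ℂ)), (fun (k'' : ℕ) (_ : idx L (cubic d (evenPeriod t)) k'')
            => (0 : ℂ)), (fun (k'' : ℕ) (x' : idx L (cubic d (evenPeriod t)) k'') => -2 * ∑ ν', (Complex.I * ((A t) k'' ν' x' : ℂ)) * (Complex.I * ((B t) k'' ν' x' : ℂ)))] : Fin 3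
            → ((k : ℕ) → (idx L (cubic d (evenPeriod t)) k → ℂ))) i) i t k (castT (cubic d (lev L k * evenPeriod t)) z, f)) atTop (𝓝 s') := by
    intro i k f z
    choose sA hsA using fun (ν' : Fin d) => hA1 k ν' f z
    choose sB hsB using fun (ν' : Fin d) => hB1 k ν' f z
    fin_cases i
    · exact ⟨0, tendsto_const_nhds⟩
    · exact ⟨0, tendsto_const_nhds⟩
    · exact ⟨-2 * ∑ ν', (Complex.I * sA ν') * (Complex.I * sB ν'), (tendsto_finsetSum _ fun ν' _ => ((hsA ν').const_mul Complex.I).mul ((hsB ν').const_mul Complex.I)).const_mul _⟩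
  obtain ⟨κ, B₀, B', hκ, hB₀, hB', Pinf, hIVL, hUD, hSR, hK, hsm⟩ :=
    conv_couplingDiagramSum_of_tendsto_background L a ha (σ := Fin 3)
      (V₁ := (fun (i : Fin 3) (t : ℕ) => (![(fun k'' ν' (x' : idx L (cubic d (evenPeriod t)) k'') => -(Complex.I * ((A t) k'' ν' x' : ℂ))), (fun k'' ν' (x' : idx L (cubic d
            (evenPeriod t)) k'') => -(Complex.I * ((B t) k'' ν' x' : ℂ))), (fun k'' ν' (x' : idx L (cubic d (evenPeriod t)) k'') => -(Complex.I * ((A t) k'' ν' x' : ℂ)) *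
            (Complex.I * ((B t) k'' ν' x' : ℂ) / ((lev L k'' : ℕ) : ℂ)))] : Fin 3 → ((k : ℕ) → Fin d → (idx L (cubic d (evenPeriod t)) k → ℂ))) i))
      (V₂ := (fun (i : Fin 3) (t : ℕ) => (![(fun k'' ν' (x' : idx L (cubic d (evenPeriod t)) k'') => -(Complex.I * ((A t) k'' ν' x' : ℂ))), (fun k'' ν' (x' : idx L (cubic d
            (evenPeriod t)) k'') => -(Complex.I * ((B t) k'' ν' x' : ℂ))), (fun k'' ν' (x' : idx L (cubic d (evenPeriod t)) k'') => -(Complex.I * ((A t) k'' ν' x' : ℂ)) *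
            (Complex.I * ((B t) k'' ν' x' : ℂ) / ((lev L k'' : ℕ) : ℂ)))] : Fin 3 → ((k : ℕ) → Fin d → (idx L (cubic d (evenPeriod t)) k → ℂ))) i))
      (W := (fun (i : Fin 3) (t : ℕ) => (![(fun (k'' : ℕ) (_ : idx L (cubic d (evenPeriod t)) k'') => (0 : ℂ)), (fun (k'' : ℕ) (_ : idx L (cubic d (evenPeriod t)) k'') => (0 :
            ℂ)), (fun (k'' : ℕ) (x' : idx L (cubic d (evenPeriod t)) k'') => -2 * ∑ ν', (Complex.I * ((A t) k'' ν' x' : ℂ)) * (Complex.I * ((B t) k'' ν' x' : ℂ)))] : Fin 3 → ((k :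
            ℕ) → (idx L (cubic d (evenPeriod t)) k → ℂ))) i))
      hL hd hne hV hV hW hV1 hV1 hW1' (Finset.univ : Finset (Fin 5)) (![1, 1, -1, -1, 1] : Fin 5 → ℂ)
      (![[none, some [1], none, some [0], none], [none, some [0], none, some [1], none], [none, some [1, 0], none], [none, some [0, 1], none], [none, some [2], none]] : Fin 5 →
            List (Option (List (Fin 3))))
  refine ⟨κ, B₀, B', hκ, hB₀, hB', Pinf, fun k => ?_, hUD, hSR, hK, hsm⟩
  -- the identity, volume by volume
  have key : ∀ t, deriv (fun r : ℝ => deriv (fun s : ℝ => (avgTow (QBlev L (cubic d (evenPeriod t))) ((L : ℝ) ^ d)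
        (fun k' => (calDalev L (cubic d (evenPeriod t)) a ha k' + covPert L (cubic d (evenPeriod t)) (fun k'' ν' (x' : idx L (cubic d (evenPeriod t)) k'') => Complex.exp
              ((Complex.I * ((A t) k'' ν' x' : ℂ) / ((lev L k'' : ℕ) : ℂ)) * ((s : ℝ) : ℂ) + (Complex.I * ((B t) k'' ν' x' : ℂ) / ((lev L k'' : ℕ) : ℂ)) * ((r : ℝ) : ℂ))) k')⁻¹)
              k)⁻¹) 0) 0
      = (∑ j ∈ (Finset.univ : Finset (Fin 5)), (![1, 1, -1, -1, 1] : Fin 5 → ℂ) j • (((![[none, some [1], none, some [0], none], [none, some [0], none, some [1], none], [none,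
            some [1, 0], none], [none, some [0, 1], none], [none, some [2], none]] : Fin 5 → List (Option (List (Fin 3)))) j).map fun o : Option (List (Fin 3)) => o.elim
            (fun t k => (unitCovB L (cubic d (evenPeriod t)) a ha k)⁻¹)
            (fun w t k => avgTow (QBlev L (cubic d (evenPeriod t))) ((L : ℝ) ^ d)
              (fun k' => List.foldr (fun i N => calGlev L (cubic d (evenPeriod t)) a ha k'
                * (Pmodel L (cubic d (evenPeriod t)) ((fun (i : Fin 3) (t : ℕ) => (![(fun k'' ν' (x' : idx L (cubic d (evenPeriod t)) k'') => -(Complex.I * ((A t) k'' ν' x' :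
                      ℂ))), (fun k'' ν' (x' : idx L (cubic d (evenPeriod t)) k'') => -(Complex.I * ((B t) k'' ν' x' : ℂ))), (fun k'' ν' (x' : idx L (cubic d (evenPeriod t)) k'')
                      => -(Complex.I * ((A t) k'' ν' x' : ℂ)) * (Complex.I * ((B t) k'' ν' x' : ℂ) / ((lev L k'' : ℕ) : ℂ)))] : Fin 3 → ((k : ℕ) → Fin d → (idx L (cubic d
                      (evenPeriod t)) k → ℂ))) i) i t) k' + (Pmodel L (cubic d (evenPeriod t)) ((fun (i : Fin 3) (t : ℕ) => (![(fun k'' ν' (x' : idx L (cubic d (evenPeriod t))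
                      k'') => -(Complex.I * ((A t) k'' ν' x' : ℂ))), (fun k'' ν' (x' : idx L (cubic d (evenPeriod t)) k'') => -(Complex.I * ((B t) k'' ν' x' : ℂ))), (fun k'' ν'
                      (x' : idx L (cubic d (evenPeriod t)) k'') => -(Complex.I * ((A t) k'' ν' x' : ℂ)) * (Complex.I * ((B t) k'' ν' x' : ℂ) / ((lev L k'' : ℕ) : ℂ)))] : Fin 3 →
                      ((k : ℕ) → Fin d → (idx L (cubic d (evenPeriod t)) k → ℂ))) i) i t) k')ᴴ
                  + Matrix.diagonal ((fun (i : Fin 3) (t : ℕ) => (![(fun (k'' : ℕ) (_ : idx L (cubic d (evenPeriod t)) k'') => (0 : ℂ)), (fun (k'' : ℕ) (_ : idx L (cubic d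
                        (evenPeriod t)) k'') => (0 : ℂ)), (fun (k'' : ℕ) (x' : idx L (cubic d (evenPeriod t)) k'') => -2 * ∑ ν', (Complex.I * ((A t) k'' ν' x' : ℂ)) * (Complex.I *
                        ((B t) k'' ν' x' : ℂ)))] : Fin 3 → ((k : ℕ) → (idx L (cubic d (evenPeriod t)) k → ℂ))) i) i t k')) * N)
                (calGlev L (cubic d (evenPeriod t)) a ha k') w) k)).prod) t k := by
    intro t
    rw [deriv_deriv_invCov_expChart₂_eq_mixedDiagram L (cubic d (evenPeriod t)) a ha (A t) (B t) k]
    simp only [Finset.sum_apply, Pi.smul_apply, Pi.list_prod_apply, Fin.sum_univ_five, Matrix.cons_val, List.map_cons, List.map_nil, List.prod_cons, List.prod_nil,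
      Option.elim, List.foldr_cons, List.foldr_nil, one_smul, neg_smul, Matrix.mul_one, Matrix.mul_assoc, sub_eq_add_neg]
  have e : (fun t μ' ν' (z : Site d (evenPeriod t)) =>
          ((deriv (fun r : ℝ => deriv (fun s : ℝ => (avgTow (QBlev L (cubic d (evenPeriod t))) ((L : ℝ) ^ d)
        (fun k' => (calDalev L (cubic d (evenPeriod t)) a ha k' + covPert L (cubic d (evenPeriod t)) (fun k'' ν' (x' : idx L (cubic d (evenPeriod t)) k'') => Complex.exp
              ((Complex.I * ((A t) k'' ν' x' : ℂ) / ((lev L k'' : ℕ) : ℂ)) * ((s : ℝ) : ℂ) + (Complex.I * ((B t) k'' ν' x' : ℂ) / ((lev L k'' : ℕ) : ℂ)) * ((r : ℝ) : ℂ))) k')⁻¹)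
              k)⁻¹) 0) 0)
            ((unitIdx L (cubic d (evenPeriod t))).symm (z, μ')) ((unitIdx L (cubic d (evenPeriod t))).symm (0, ν'))).re)
      = fun t μ' ν' (z : Site d (evenPeriod t)) =>
          (((∑ j ∈ (Finset.univ : Finset (Fin 5)), (![1, 1, -1, -1, 1] : Fin 5 → ℂ) j • (((![[none, some [1], none, some [0], none], [none, some [0], none, some [1], none], [none,
                some [1, 0], none], [none, some [0, 1], none], [none, some [2], none]] : Fin 5 → List (Option (List (Fin 3)))) j).map fun o : Option (List (Fin 3)) => o.elim
            (fun t k => (unitCovB L (cubic d (evenPeriod t)) a ha k)⁻¹)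
            (fun w t k => avgTow (QBlev L (cubic d (evenPeriod t))) ((L : ℝ) ^ d)
              (fun k' => List.foldr (fun i N => calGlev L (cubic d (evenPeriod t)) a ha k'
                * (Pmodel L (cubic d (evenPeriod t)) ((fun (i : Fin 3) (t : ℕ) => (![(fun k'' ν' (x' : idx L (cubic d (evenPeriod t)) k'') => -(Complex.I * ((A t) k'' ν' x' :
                      ℂ))), (fun k'' ν' (x' : idx L (cubic d (evenPeriod t)) k'') => -(Complex.I * ((B t) k'' ν' x' : ℂ))), (fun k'' ν' (x' : idx L (cubic d (evenPeriod t)) k'')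
                      => -(Complex.I * ((A t) k'' ν' x' : ℂ)) * (Complex.I * ((B t) k'' ν' x' : ℂ) / ((lev L k'' : ℕ) : ℂ)))] : Fin 3 → ((k : ℕ) → Fin d → (idx L (cubic d
                      (evenPeriod t)) k → ℂ))) i) i t) k' + (Pmodel L (cubic d (evenPeriod t)) ((fun (i : Fin 3) (t : ℕ) => (![(fun k'' ν' (x' : idx L (cubic d (evenPeriod t))
                      k'') => -(Complex.I * ((A t) k'' ν' x' : ℂ))), (fun k'' ν' (x' : idx L (cubic d (evenPeriod t)) k'') => -(Complex.I * ((B t) k'' ν' x' : ℂ))), (fun k'' ν'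
                      (x' : idx L (cubic d (evenPeriod t)) k'') => -(Complex.I * ((A t) k'' ν' x' : ℂ)) * (Complex.I * ((B t) k'' ν' x' : ℂ) / ((lev L k'' : ℕ) : ℂ)))] : Fin 3 →
                      ((k : ℕ) → Fin d → (idx L (cubic d (evenPeriod t)) k → ℂ))) i) i t) k')ᴴ
                  + Matrix.diagonal ((fun (i : Fin 3) (t : ℕ) => (![(fun (k'' : ℕ) (_ : idx L (cubic d (evenPeriod t)) k'') => (0 : ℂ)), (fun (k'' : ℕ) (_ : idx L (cubic d
                        (evenPeriod t)) k'') => (0 : ℂ)), (fun (k'' : ℕ) (x' : idx L (cubic d (evenPeriod t)) k'') => -2 * ∑ ν', (Complex.I * ((A t) k'' ν' x' : ℂ)) * (Complex.I *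
                        ((B t) k'' ν' x' : ℂ)))] : Fin 3 → ((k : ℕ) → (idx L (cubic d (evenPeriod t)) k → ℂ))) i) i t k')) * N)
                (calGlev L (cubic d (evenPeriod t)) a ha k') w) k)).prod) t k)
            ((unitIdx L (cubic d (evenPeriod t))).symm (z, μ')) ((unitIdx L (cubic d (evenPeriod t))).symm (0, ν'))).re := by
    funext t μ' ν' z
    rw [key t]
  rw [e]
  exact hIVL k

end End

end Summit.QuantumFields.BalabanUV.Beta.GAN24.ExponentialChartMixedCovariantTaylor

end
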